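import Summits.QuantumFields.BalabanUV.Beta.EriceRemainderEnclosureHistoryAutonomyComparisonAgeCompositionNearPairSeparatedAges
import Summits.QuantumFields.BalabanUV.Beta.EriceRemainderEnclosureHistoryAutonomyComparisonAgeCompositionOldPairCapWider
import Summits.QuantumFields.BalabanUV.Beta.EriceRemainderEnclosureHistoryAutonomyComparisonAgeCompositionOldPairCapWidest

/-!
# EriceRemainderEnclosureHistoryAutonomyComparisonAgeCompositionWideOldPairSeparatedAges — (E102f) route (N), first order: WIDE OLD PAIRS AS CASCADE LEVELS.
# (E99d) typed the END `0 ≤ ε ≤ e` along every admissible flow below a ×61 chain of NEAR old pairs (`p_j ≤ 2a_j`, cap `0.617`); wider pairs were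
# levels only through the block caps of the argmax certificate (spans 3 ∕ 4 at `13∕20 ∕ 11∕16`: chains ×76 ∕ ×100, (E100h)∕(E100f)).  With the wide
# pair caps of (E102c–e) (deficit product + split K letter: `0.635 ∕ 0.645 ∕ 0.665 ∕ 0.68 ∕ 0.70 ∕ 0.715 ∕ 0.74 ∕ 0.755` on the brackets up to 32),
# assembled here as **`wide_pair_load_le4 ∕ 8 ∕ 16 ∕ 32`** (`Σ_{k∈{lo,hi}} x_k ≤ 0.645 ∕ 0.68 ∕ 0.715 ∕ 0.755` for `hi ≤ 4lo ∕ 8lo ∕ 16lo ∕ 32lo`), the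
# older levels of (E99c) `flow_nonneg_cluster_levels_of_caps` may be OLD PAIRS OF SPAN `F` with the pair cap `s` a HYPOTHESIS
# (**`flow_nonneg_wide_pair_levels_of_cap`**, parametric in `(s, F)` and the youngest cluster), whence: the census young pair `{1,k₂}` (`k₂ ≤ 29`,
# cap `0.8333`, `κ = 1∕5`) below a chain of old pairs of span `≤ 4` in separation ×73 (`3.296 ≤ 3.2996`), any young age (cap `0.7072`, `κ = 47∕200`)
# in ×72 (`3.4213 ≤ 3.4419`); span `≤ 8`: ×95 for both (`3.464 ≤ 3.496`); span `≤ 16`: ×128 (`3.632 ≤ 3.6352`)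
# (**`flow_nonneg_census_young_pair_wide_pairs4 ∕ 8 ∕ 16`**, **`flow_nonneg_young_age_wide_pairs4 ∕ 8`**).

Cell `pub-balaban`, β-function sub-cell, BINDER row D4 «RemainderConst leaves for Bałaban's split» (`HOME/BINDER-OWNERS.md`; owner lineage `b2b-balaban-beta-an4`;
this file by co-owner #2 lineage `b2b-balaban-beta-d4-p2`, generation 89), β-FLOW TEAM duty (1), FREEZE (0) honoured (def-free; nothing restated).

HONEST FRAMING (page 1, verbatim and binding).  *"Discharging BetaPertH makes Bałaban's UV stability UNCONDITIONAL — a real constructive-QFT result; it is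
NOT the continuum limit and NOT the Clay problem."*  THIS FILE DISCHARGES NOTHING OF THE KIND.  Elementary real algebra ∕ real analysis about ABSTRACT
functionals on a box ]0,γ]^ℕ with displayed floors, profiles and signs, and the FIRST-ORDER renewal objects of route (N) built from them — hypotheses of a
census, not facts; the form, signs, ages and moments of Bałaban's (1.22) limit functional are NOT PRINTED ([I] p. 298; GAPS G-t4-U2-1∕-2) and NOT asserted.
Row D4 class UNCHANGED (critical-path width 0; instance 0∕1; D4 DISCHARGE NO DATE).  HONEST DEPENDENCY: continuum YM on T⁴ ⇐ BetaPertH ∧ nine spine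
estimates (0/9 proved); BetaPertH ⇐ (D1) ∧ (D4) ∧ CAP+tail; G-an2-4 gates asym, D1 and NE2/3/4.

THE POINT (README `HOME/b2b-balaban-beta-d4-p2/g89/README.md` §2).  Uses (E99c) `flow_nonneg_cluster_levels_of_caps`, (E99b) `near_pair_load_le`, (E102c–e)
`old_pair_load_le_span3 ∕ 4 ∕ 6 ∕ 8 ∕ 12 ∕ 16 ∕ 24 ∕ 32`, (E97c) `young_pair_load_le`, (E94b) `load_le_of_sq` BY NAME; the proof of §2 is (E99d)'s with the
span and the cap freed.  NOT CLAIMED: BLOCKS of three or more ages at the pair values (README §3: numerically true, certificate untyped — use the argmax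
blocks (E100c∕h∕f)); span `> 32`; anything printed — NOT B12 Thm 2, NOT BetaPertH, NOT continuum, NOT Clay.

WHAT IS PROVED ([folklore]; 0 `def`, 0 sorry).  §1 **`wide_pair_load_le4`**, **`wide_pair_load_le8`**, **`wide_pair_load_le16`**, **`wide_pair_load_le32`**.
§2 **`flow_nonneg_wide_pair_levels_of_cap`**.  §3 **`flow_nonneg_census_young_pair_wide_pairs4 ∕ 8 ∕ 16`**, **`flow_nonneg_young_age_wide_pairs4 ∕ 8`**.
-/
noncomputable section
open Finset

namespace Summit.QuantumFields.BalabanUV.Beta.EriceRemainderEnclosureHistoryAutonomyComparisonAgeCompositionWideOldPairSeparatedAges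

open Literature.MathematicalPhysics.QuantumFieldTheory.Balaban1983to89
open Literature.MathematicalPhysics.QuantumFieldTheory.Balaban1983to89.T4BetaStationary
open Literature.MathematicalPhysics.QuantumFieldTheory.Balaban1983to89.T4BetaFlowWellPosed
open Summit.QuantumFields.BalabanUV.Beta.EriceRemainderEnclosureHistoryAutonomyComparisonAgeCompositionYoungPairMoment (load_le_of_sq)
open Summit.QuantumFields.BalabanUV.Beta.EriceRemainderEnclosureHistoryAutonomyComparisonAgeCompositionOldPairCap (near_pair_load_le)
open Summit.QuantumFields.BalabanUV.Beta.EriceRemainderEnclosureHistoryAutonomyComparisonAgeCompositionClusterLevels (flow_nonneg_cluster_levels_of_caps)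
open Summit.QuantumFields.BalabanUV.Beta.EriceRemainderEnclosureHistoryAutonomyComparisonAgeCompositionYoungPairCapSeparatedAges (young_pair_load_le)
open Summit.QuantumFields.BalabanUV.Beta.EriceRemainderEnclosureHistoryAutonomyComparisonAgeCompositionOldPairCapWide (old_pair_load_le_span3 old_pair_load_le_span4)
open Summit.QuantumFields.BalabanUV.Beta.EriceRemainderEnclosureHistoryAutonomyComparisonAgeCompositionOldPairCapWider (old_pair_load_le_span6 old_pair_load_le_span8 old_pair_load_le_span12)
open Summit.QuantumFields.BalabanUV.Beta.EriceRemainderEnclosureHistoryAutonomyComparisonAgeCompositionOldPairCapWidest (old_pair_load_le_span16 old_pair_load_le_span24 old_pair_load_le_span32)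

variable {B : (ℕ → ℝ) → ℝ} {γ b gIR : ℝ} {L : ℕ → ℝ} {K : ℕ} {h g : ℕ → ℝ}

/-! ## §1 The wide pair caps assembled -/

/-- **THE WIDE OLD-PAIR CAP UP TO SPAN 4.**  Old ages `56 ≤ lo ≤ hi ≤ 4·lo`, `hi < K`: `Σ_{k∈{lo,hi}} x_k(m) ≤ 129 / 200` at every pin (`lo = hi` or `hi ≤ 2lo`:
(E99b) `near_pair_load_le` `0.617`; then the span tables `old_pair_load_le_span3`, `old_pair_load_le_span4`). [folklore] -/
theorem wide_pair_load_le4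
    (hmono : ∀ u v : ℕ → ℝ, SeqBox γ u → SeqBox γ v → (∀ j, u j ≤ v j) → B u ≤ B v)
    (hL : ∀ k, 0 ≤ L k) (hb : 0 < b) (hlo : ∀ u, SeqBox γ u → b ≤ B u) (hdom : ∀ u, SeqBox γ u → ∑ k ∈ range K, L k * u k ≤ B u)
    (hh : SeqBox γ h) (hf : MemFlow B gIR h) {lo hi : ℕ} (hlo56 : 56 ≤ lo) (hlohi : lo ≤ hi) (hhi : hi ≤ 4 * lo) (hhiK : hi < K) (m : ℕ) :
    ∑ k ∈ ({lo, hi} : Finset ℕ), (k : ℝ) * (L k * h (m + k) ^ 3 / 2) ≤ 129 / 200 := by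
  rcases le_or_gt hi (2 * lo) with h2 | h2
  · exact (near_pair_load_le hmono hL hb hlo hdom hh hf hlo56 hlohi h2 hhiK m).trans (by norm_num)
  rw [sum_pair (show lo ≠ hi by omega)]
  rcases le_or_gt hi (3 * lo) with h3 | h3
  · exact (old_pair_load_le_span3 hmono hL hb hlo hdom hh hf hlo56 h2 h3 hhiK m).trans (by norm_num)
  exact (old_pair_load_le_span4 hmono hL hb hlo hdom hh hf hlo56 h3 hhi hhiK m)

/-- **THE WIDE OLD-PAIR CAP UP TO SPAN 8.**  Old ages `56 ≤ lo ≤ hi ≤ 8·lo`, `hi < K`: `Σ_{k∈{lo,hi}} x_k(m) ≤ 17 / 25` at every pin (`lo = hi` or `hi ≤ 2lo`: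
(E99b) `near_pair_load_le` `0.617`; then the span tables `old_pair_load_le_span3`, `old_pair_load_le_span4`, `old_pair_load_le_span6`, `old_pair_load_le_span8`). [folklore] -/
theorem wide_pair_load_le8
    (hmono : ∀ u v : ℕ → ℝ, SeqBox γ u → SeqBox γ v → (∀ j, u j ≤ v j) → B u ≤ B v)
    (hL : ∀ k, 0 ≤ L k) (hb : 0 < b) (hlo : ∀ u, SeqBox γ u → b ≤ B u) (hdom : ∀ u, SeqBox γ u → ∑ k ∈ range K, L k * u k ≤ B u)
    (hh : SeqBox γ h) (hf : MemFlow B gIR h) {lo hi : ℕ} (hlo56 : 56 ≤ lo) (hlohi : lo ≤ hi) (hhi : hi ≤ 8 * lo) (hhiK : hi < K) (m : ℕ) :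
    ∑ k ∈ ({lo, hi} : Finset ℕ), (k : ℝ) * (L k * h (m + k) ^ 3 / 2) ≤ 17 / 25 := by
  rcases le_or_gt hi (2 * lo) with h2 | h2
  · exact (near_pair_load_le hmono hL hb hlo hdom hh hf hlo56 hlohi h2 hhiK m).trans (by norm_num)
  rw [sum_pair (show lo ≠ hi by omega)]
  rcases le_or_gt hi (3 * lo) with h3 | h3
  · exact (old_pair_load_le_span3 hmono hL hb hlo hdom hh hf hlo56 h2 h3 hhiK m).trans (by norm_num)
  rcases le_or_gt hi (4 * lo) with h4 | h4
  · exact (old_pair_load_le_span4 hmono hL hb hlo hdom hh hf hlo56 h3 h4 hhiK m).trans (by norm_num)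
  rcases le_or_gt hi (6 * lo) with h6 | h6
  · exact (old_pair_load_le_span6 hmono hL hb hlo hdom hh hf hlo56 h4 h6 hhiK m).trans (by norm_num)
  exact (old_pair_load_le_span8 hmono hL hb hlo hdom hh hf hlo56 h6 hhi hhiK m)

/-- **THE WIDE OLD-PAIR CAP UP TO SPAN 16.**  Old ages `56 ≤ lo ≤ hi ≤ 16·lo`, `hi < K`: `Σ_{k∈{lo,hi}} x_k(m) ≤ 143 / 200` at every pin (`lo = hi` or `hi ≤ 2lo`:
(E99b) `near_pair_load_le` `0.617`; then the span tables `old_pair_load_le_span3`, `old_pair_load_le_span4`, `old_pair_load_le_span6`, `old_pair_load_le_span8`, `old_pair_load_le_span12`, `old_pair_load_le_span16`). [folklore] -/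
theorem wide_pair_load_le16
    (hmono : ∀ u v : ℕ → ℝ, SeqBox γ u → SeqBox γ v → (∀ j, u j ≤ v j) → B u ≤ B v)
    (hL : ∀ k, 0 ≤ L k) (hb : 0 < b) (hlo : ∀ u, SeqBox γ u → b ≤ B u) (hdom : ∀ u, SeqBox γ u → ∑ k ∈ range K, L k * u k ≤ B u)
    (hh : SeqBox γ h) (hf : MemFlow B gIR h) {lo hi : ℕ} (hlo56 : 56 ≤ lo) (hlohi : lo ≤ hi) (hhi : hi ≤ 16 * lo) (hhiK : hi < K) (m : ℕ) :
    ∑ k ∈ ({lo, hi} : Finset ℕ), (k : ℝ) * (L k * h (m + k) ^ 3 / 2) ≤ 143 / 200 := by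
  rcases le_or_gt hi (2 * lo) with h2 | h2
  · exact (near_pair_load_le hmono hL hb hlo hdom hh hf hlo56 hlohi h2 hhiK m).trans (by norm_num)
  rw [sum_pair (show lo ≠ hi by omega)]
  rcases le_or_gt hi (3 * lo) with h3 | h3
  · exact (old_pair_load_le_span3 hmono hL hb hlo hdom hh hf hlo56 h2 h3 hhiK m).trans (by norm_num)
  rcases le_or_gt hi (4 * lo) with h4 | h4
  · exact (old_pair_load_le_span4 hmono hL hb hlo hdom hh hf hlo56 h3 h4 hhiK m).trans (by norm_num)
  rcases le_or_gt hi (6 * lo) with h6 | h6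
  · exact (old_pair_load_le_span6 hmono hL hb hlo hdom hh hf hlo56 h4 h6 hhiK m).trans (by norm_num)
  rcases le_or_gt hi (8 * lo) with h8 | h8
  · exact (old_pair_load_le_span8 hmono hL hb hlo hdom hh hf hlo56 h6 h8 hhiK m).trans (by norm_num)
  rcases le_or_gt hi (12 * lo) with h12 | h12
  · exact (old_pair_load_le_span12 hmono hL hb hlo hdom hh hf hlo56 h8 h12 hhiK m).trans (by norm_num)
  exact (old_pair_load_le_span16 hmono hL hb hlo hdom hh hf hlo56 h12 hhi hhiK m)

/-- **THE WIDE OLD-PAIR CAP UP TO SPAN 32.**  Old ages `56 ≤ lo ≤ hi ≤ 32·lo`, `hi < K`: `Σ_{k∈{lo,hi}} x_k(m) ≤ 151 / 200` at every pin (`lo = hi` or `hi ≤ 2lo`: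
(E99b) `near_pair_load_le` `0.617`; then the span tables `old_pair_load_le_span3`, `old_pair_load_le_span4`, `old_pair_load_le_span6`, `old_pair_load_le_span8`, `old_pair_load_le_span12`, `old_pair_load_le_span16`, `old_pair_load_le_span24`, `old_pair_load_le_span32`). [folklore] -/
theorem wide_pair_load_le32
    (hmono : ∀ u v : ℕ → ℝ, SeqBox γ u → SeqBox γ v → (∀ j, u j ≤ v j) → B u ≤ B v)
    (hL : ∀ k, 0 ≤ L k) (hb : 0 < b) (hlo : ∀ u, SeqBox γ u → b ≤ B u) (hdom : ∀ u, SeqBox γ u → ∑ k ∈ range K, L k * u k ≤ B u)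
    (hh : SeqBox γ h) (hf : MemFlow B gIR h) {lo hi : ℕ} (hlo56 : 56 ≤ lo) (hlohi : lo ≤ hi) (hhi : hi ≤ 32 * lo) (hhiK : hi < K) (m : ℕ) :
    ∑ k ∈ ({lo, hi} : Finset ℕ), (k : ℝ) * (L k * h (m + k) ^ 3 / 2) ≤ 151 / 200 := by
  rcases le_or_gt hi (2 * lo) with h2 | h2
  · exact (near_pair_load_le hmono hL hb hlo hdom hh hf hlo56 hlohi h2 hhiK m).trans (by norm_num)
  rw [sum_pair (show lo ≠ hi by omega)]
  rcases le_or_gt hi (3 * lo) with h3 | h3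
  · exact (old_pair_load_le_span3 hmono hL hb hlo hdom hh hf hlo56 h2 h3 hhiK m).trans (by norm_num)
  rcases le_or_gt hi (4 * lo) with h4 | h4
  · exact (old_pair_load_le_span4 hmono hL hb hlo hdom hh hf hlo56 h3 h4 hhiK m).trans (by norm_num)
  rcases le_or_gt hi (6 * lo) with h6 | h6
  · exact (old_pair_load_le_span6 hmono hL hb hlo hdom hh hf hlo56 h4 h6 hhiK m).trans (by norm_num)
  rcases le_or_gt hi (8 * lo) with h8 | h8
  · exact (old_pair_load_le_span8 hmono hL hb hlo hdom hh hf hlo56 h6 h8 hhiK m).trans (by norm_num)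
  rcases le_or_gt hi (12 * lo) with h12 | h12
  · exact (old_pair_load_le_span12 hmono hL hb hlo hdom hh hf hlo56 h8 h12 hhiK m).trans (by norm_num)
  rcases le_or_gt hi (16 * lo) with h16 | h16
  · exact (old_pair_load_le_span16 hmono hL hb hlo hdom hh hf hlo56 h12 h16 hhiK m).trans (by norm_num)
  rcases le_or_gt hi (24 * lo) with h24 | h24
  · exact (old_pair_load_le_span24 hmono hL hb hlo hdom hh hf hlo56 h16 h24 hhiK m).trans (by norm_num)
  exact (old_pair_load_le_span32 hmono hL hb hlo hdom hh hf hlo56 h24 hhi hhiK m)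

/-! ## §2 Wide old pairs above any capped youngest cluster (parametric in the span and the cap) -/

/-- **WIDE OLD PAIRS AS LEVELS, PARAMETRIC FORM.**  As (E99d) `flow_nonneg_near_pair_levels_of_cap` with the span `F` and the pair cap `s` FREE: the
youngest level is ANY cluster `S₀ ⊂ [1, K)` with window `hi₀` (`56 ≤ R₀·hi₀`) and a typed cap `Σ_{k∈S₀} x_k(q) ≤ s₀`; the levels `1 ≤ j < r` are old
pairs `{a j, p j}`, `a j ≤ p j ≤ F·a j` (`p j < K`), in separation `R₀·hi₀ ≤ a 1`, `R₀·p j ≤ a (j+1)`; a PAIR CAP `Σ_{k∈{lo,hi}} x_k(q) ≤ s` for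
`56 ≤ lo ≤ hi ≤ F·lo`, `hi < K` (a hypothesis: §1); the profile vanishes off `S₀ ∪ ⋃_j {a j, p j}`; closure `κ > 0`, `s ≥ 0`, `s₀(1+κ) ≤ 1`,
`s(1+κ) < 1`, `κ + 4s(1+κ) ≤ R₀(1 − s(1+κ))κ`, `R₀ ≥ 2`.  THEN `0 ≤ ε ≤ e` at every pin, every horizon, every `r ≥ 1` ((E99c)). [folklore] -/
theorem flow_nonneg_wide_pair_levels_of_cap
    (hmono : ∀ u v : ℕ → ℝ, SeqBox γ u → SeqBox γ v → (∀ j, u j ≤ v j) → B u ≤ B v)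
    (hL : ∀ k, 0 ≤ L k) (hb : 0 < b) (hlo : ∀ u, SeqBox γ u → b ≤ B u) (hdom : ∀ u, SeqBox γ u → ∑ k ∈ range K, L k * u k ≤ B u)
    (hh : SeqBox γ h) (hf : MemFlow B gIR h) (hg : ∀ t, 0 < g t ∧ g t ≤ 1)
    (hgF : ∀ t, 1 ≤ g t * (1 + ∑ k ∈ range K, L k * h (t + k) ^ 3 / 2)) (hK : 1 ≤ K)
    {κ s₀ s : ℝ} {R₀ F : ℕ} (hκ : 0 < κ) (hs : 0 ≤ s) (hs₀C : s₀ * (1 + κ) ≤ 1) (hsC : s * (1 + κ) < 1)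
    (hR : κ + 4 * s * (1 + κ) ≤ (R₀ : ℝ) * (1 - s * (1 + κ)) * κ) (hR2 : 2 ≤ R₀)
    (hpair : ∀ lo hi q : ℕ, 56 ≤ lo → lo ≤ hi → hi ≤ F * lo → hi < K →
      ∑ k ∈ ({lo, hi} : Finset ℕ), (k : ℝ) * (L k * h (q + k) ^ 3 / 2) ≤ s)
    {S₀ : Finset ℕ} {hi₀ : ℕ} (hS₀K : ∀ k ∈ S₀, 1 ≤ k ∧ k < K) (hS₀hi : ∀ k ∈ S₀, k ≤ hi₀) (hR56 : 56 ≤ R₀ * hi₀)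
    (hcap0 : ∀ q, ∑ k ∈ S₀, (k : ℝ) * (L k * h (q + k) ^ 3 / 2) ≤ s₀)
    {r : ℕ} {a p : ℕ → ℕ} (hr : 1 ≤ r) (hap : ∀ j, 1 ≤ j → j < r → a j ≤ p j ∧ p j ≤ F * a j) (hpK : ∀ j, 1 ≤ j → j < r → p j < K)
    (hsep0 : 1 < r → R₀ * hi₀ ≤ a 1) (hsep : ∀ j, 1 ≤ j → j + 1 < r → R₀ * p j ≤ a (j + 1))
    (hLa : ∀ l, l < K → l ∉ S₀ → (∀ j, 1 ≤ j → j < r → l ≠ a j ∧ l ≠ p j) → L l = 0)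
    {N : ℕ} {KL : ℕ → ℕ → ℕ → ℝ}
    (hKL : ∀ k n l, KL k n l = if 0 < k ∧ k < K ∧ l < k then L k * h (n + k) ^ 3 / 2 * ∏ t ∈ Ico (n + 1 + l) (n + k + 1), g t else 0)
    {KA : ℕ → ℕ → ℕ → ℝ} {RA : ℕ → (ℕ → ℝ) → ℕ → ℝ}
    (hRA : ∀ i v m, RA i v m = ∑ l ∈ range K, KA i m l * v (m + 1 + l))
    (hKA : ∀ i m l, KA i m l = KL i m l + KA (i + 1) m l) (hKAtop : ∀ m l, KA K m l = 0)
    {e ε : ℕ → ℝ} (he0 : ∀ m, 0 ≤ e m) (hea : ∀ m, e (m + 1) ≤ e m)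
    (hεt : ∀ m, N < m → ε m = 0) (hεrec : ∀ m, ε m = e m - RA 1 ε m) : ∀ m, 0 ≤ ε m ∧ ε m ≤ e m := by
  have hR1 : 1 ≤ R₀ := by omega
  -- the window of each level and the chain of separations
  obtain ⟨HI, hHI⟩ : ∃ HI : ℕ → ℕ, ∀ j, HI j = if j = 0 then hi₀ else p j := ⟨_, fun _ => rfl⟩
  have hHI0 : HI 0 = hi₀ := by rw [hHI]; simp
  have hHIS : ∀ j, 1 ≤ j → HI j = p j := fun j hj => by rw [hHI, if_neg (by omega)]
  have hchain : ∀ i j, i < j → j < r → R₀ * HI i ≤ a j := by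
    intro i j hij hjr
    induction j, hij using Nat.le_induction with
    | base =>
      rcases Nat.eq_zero_or_pos i with rfl | hi
      · rw [hHI0]; exact hsep0 (by omega)
      · rw [hHIS i hi]; exact hsep i hi (by omega)
    | succ j hle ih =>
      have h1 := ih (by omega)
      have h2 := hsep j (by omega) hjr
      have h3 := (hap j (by omega) (by omega)).1
      have h4 : p j ≤ R₀ * p j := Nat.le_mul_of_pos_left _ (by omega)
      omega
  have ha56 : ∀ j, 1 ≤ j → j < r → 56 ≤ a j := by
    intro j hj hjr
    have := hchain 0 j (by omega) hjr
    rw [hHI0] at this; omega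
  refine flow_nonneg_cluster_levels_of_caps hmono hL hb hlo hdom hh hf hg hgF hK hκ hs hs₀C hsC hR
    (r := r) (S := fun j => if j = 0 then S₀ else {a j, p j}) (lo := fun j => if j = 0 then 1 else a j) (hi := HI)
    (fun j hj k hk => ?_) (fun j hj k hk => ?_) (fun j hj k hk => ?_) (fun j hj1 hjr => ?_) (fun j hj => ?_) (fun i j hij hjr => ?_)
    (fun l hl hno => ?_) (fun q => ?_) (fun j q hj1 hjr => ?_) hKL hRA hKA hKAtop he0 hea hεt hεrec
  · -- members are ages in [1, K)
    by_cases hj0 : j = 0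
    · subst hj0; simp only [if_true] at hk; exact hS₀K k hk
    · simp only [if_neg hj0, mem_insert, mem_singleton] at hk
      have h1 := ha56 j (by omega) hj; have h2 := hap j (by omega) hj; have h3 := hpK j (by omega) hj
      rcases hk with rfl | rfl <;> omega
  · -- members are ≥ lo
    by_cases hj0 : j = 0
    · subst hj0; simp only [if_true] at hk ⊢; exact (hS₀K k hk).1
    · simp only [if_neg hj0, mem_insert, mem_singleton] at hk ⊢
      have h2 := hap j (by omega) hj
      rcases hk with rfl | rfl <;> omega
  · -- members are ≤ hi
    by_cases hj0 : j = 0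
    · subst hj0; simp only [if_true] at hk; rw [hHI0]; exact hS₀hi k hk
    · simp only [if_neg hj0, mem_insert, mem_singleton] at hk
      rw [hHIS j (by omega)]
      have h2 := hap j (by omega) hj
      rcases hk with rfl | rfl <;> omega
  · -- lo ≤ hi for the older levels
    simp only [if_neg (show j ≠ 0 by omega)]
    rw [hHIS j hj1]; exact (hap j hj1 hjr).1
  · -- separation R₀·hi j ≤ lo (j+1) = a (j+1)
    simp only [if_neg (Nat.succ_ne_zero j)]
    exact hchain j (j + 1) (by omega) hj
  · -- the clusters are pairwise disjoint: everything in level i lies below everything in level j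
    have hlt : ∀ x, x ∈ (if i = 0 then S₀ else ({a i, p i} : Finset ℕ)) → ∀ y, y ∈ (if j = 0 then S₀ else ({a j, p j} : Finset ℕ)) → x < y := by
      intro x hx y hy
      have hj0 : j ≠ 0 := by omega
      simp only [if_neg hj0, mem_insert, mem_singleton] at hy
      have hc := hchain i j hij hjr
      have hay : a j ≤ y := by have := (hap j (by omega) hjr).1; rcases hy with rfl | rfl <;> omega
      have hxH : 1 ≤ x ∧ x ≤ HI i := by
        by_cases hi0 : i = 0
        · subst hi0; simp only [if_true] at hx; rw [hHI0]; exact ⟨(hS₀K x hx).1, hS₀hi x hx⟩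
        · simp only [if_neg hi0, mem_insert, mem_singleton] at hx
          rw [hHIS i (by omega)]
          have h1 := ha56 i (by omega) (by omega); have h2 := hap i (by omega) (by omega)
          rcases hx with rfl | rfl <;> omega
      have h6 : 2 * HI i ≤ R₀ * HI i := Nat.mul_le_mul_right _ hR2
      omega
    exact disjoint_left.mpr fun x hx hx' => lt_irrefl x (hlt x hx x hx')
  · -- the profile vanishes off the clusters
    refine hLa l hl (by simpa using hno 0 (by omega)) fun j hj1 hjr => ?_
    have := hno j hjr
    simp only [if_neg (show j ≠ 0 by omega), mem_insert, mem_singleton, not_or] at this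
    exact this
  · -- the youngest cap
    simp only [if_true]; exact hcap0 q
  · -- the older caps: the pair cap
    simp only [if_neg (show j ≠ 0 by omega)]
    have h2 := hap j hj1 hjr
    exact hpair (a j) (p j) q (ha56 j hj1 hjr) h2.1 h2.2 (hpK j hj1 hjr)

/-! ## §3 The census young pair, or any young age, below a chain of wide old pairs -/

/-- **THE CENSUS YOUNG PAIR `{1, k₂}`, `2 ≤ k₂ ≤ 29`, BELOW A ×73 CHAIN OF OLD PAIRS OF SPAN `≤ 4`, ANY NUMBER OF LEVELS.**  Profile carried by
`{1, k₂} ∪ ⋃_{1≤j<r} {a j, p j}` with `a j ≤ p j ≤ 4·a j`, `73k₂ ≤ a 1`, `73·p j ≤ a (j+1)`: `0 ≤ ε ≤ e` at every pin, every horizon, every damping of the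
self-consistent class (`κ = 1∕5`, caps `0.8333` (E97c) and `129 / 200` (§1), `R₀ = 73`: `3.296 ≤ 3.2996`). [folklore] -/
theorem flow_nonneg_census_young_pair_wide_pairs4
    (hmono : ∀ u v : ℕ → ℝ, SeqBox γ u → SeqBox γ v → (∀ j, u j ≤ v j) → B u ≤ B v)
    (hL : ∀ k, 0 ≤ L k) (hb : 0 < b) (hlo : ∀ u, SeqBox γ u → b ≤ B u) (hdom : ∀ u, SeqBox γ u → ∑ k ∈ range K, L k * u k ≤ B u)
    (hh : SeqBox γ h) (hf : MemFlow B gIR h) (hg : ∀ t, 0 < g t ∧ g t ≤ 1)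
    (hgF : ∀ t, 1 ≤ g t * (1 + ∑ k ∈ range K, L k * h (t + k) ^ 3 / 2))
    {k₂ : ℕ} (hk2 : 2 ≤ k₂) (hk29 : k₂ ≤ 29) (hk2K : k₂ < K)
    {r : ℕ} {a p : ℕ → ℕ} (hr : 1 ≤ r) (hap : ∀ j, 1 ≤ j → j < r → a j ≤ p j ∧ p j ≤ 4 * a j) (hpK : ∀ j, 1 ≤ j → j < r → p j < K)
    (hsep0 : 1 < r → 73 * k₂ ≤ a 1) (hsep : ∀ j, 1 ≤ j → j + 1 < r → 73 * p j ≤ a (j + 1))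
    (hLa : ∀ l, l < K → l ≠ 1 → l ≠ k₂ → (∀ j, 1 ≤ j → j < r → l ≠ a j ∧ l ≠ p j) → L l = 0)
    {N : ℕ} {KL : ℕ → ℕ → ℕ → ℝ}
    (hKL : ∀ k n l, KL k n l = if 0 < k ∧ k < K ∧ l < k then L k * h (n + k) ^ 3 / 2 * ∏ t ∈ Ico (n + 1 + l) (n + k + 1), g t else 0)
    {KA : ℕ → ℕ → ℕ → ℝ} {RA : ℕ → (ℕ → ℝ) → ℕ → ℝ}
    (hRA : ∀ i v m, RA i v m = ∑ l ∈ range K, KA i m l * v (m + 1 + l))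
    (hKA : ∀ i m l, KA i m l = KL i m l + KA (i + 1) m l) (hKAtop : ∀ m l, KA K m l = 0)
    {e ε : ℕ → ℝ} (he0 : ∀ m, 0 ≤ e m) (hea : ∀ m, e (m + 1) ≤ e m)
    (hεt : ∀ m, N < m → ε m = 0) (hεrec : ∀ m, ε m = e m - RA 1 ε m) : ∀ m, 0 ≤ ε m ∧ ε m ≤ e m := by
  refine flow_nonneg_wide_pair_levels_of_cap hmono hL hb hlo hdom hh hf hg hgF (by omega) (κ := 1 / 5) (s₀ := 8333 / 10000) (s := 129 / 200)
    (R₀ := 73) (F := 4) (by norm_num) (by norm_num) (by norm_num) (by norm_num) (by norm_num) (by norm_num)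
    (fun lo hi q h1 h2 h3 h4 => wide_pair_load_le4 hmono hL hb hlo hdom hh hf h1 h2 h3 h4 q) (S₀ := {1, k₂}) (hi₀ := k₂)
    (fun k hk => ?_) (fun k hk => ?_) (by omega) (fun q => ?_) hr hap hpK hsep0 hsep (fun l hl hl0 hno => ?_) hKL hRA hKA hKAtop he0 hea hεt hεrec
  · simp only [mem_insert, mem_singleton] at hk; rcases hk with rfl | rfl <;> omega
  · simp only [mem_insert, mem_singleton] at hk; rcases hk with rfl | rfl <;> omega
  · rw [sum_pair (show (1 : ℕ) ≠ k₂ by omega), Nat.cast_one, one_mul]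
    exact young_pair_load_le hmono hL hb hlo hdom hh hf hk2 hk29 hk2K q
  · refine hLa l hl (fun h1 => hl0 ?_) (fun h2 => hl0 ?_) hno
    · rw [h1]; exact mem_insert_self _ _
    · rw [h2]; exact mem_insert_of_mem (mem_singleton_self _)

/-- **ANY YOUNG AGE BELOW A ×72 CHAIN OF OLD PAIRS OF SPAN `≤ 4`, ANY NUMBER OF LEVELS.**  Profile carried by `{a₀} ∪ ⋃_{1≤j<r} {a j, p j}` with
`a₀ ≥ 1` ARBITRARY, `a j ≤ p j ≤ 4·a j`, `72a₀ ≤ a 1`, `72·p j ≤ a (j+1)`: `0 ≤ ε ≤ e` at every pin (`κ = 47 / 200`, caps `0.7072` ((E94b) `load_le_of_sq`,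
any age) and `129 / 200` (§1), `R₀ = 72`: `3.4213 ≤ 3.4419`). [folklore] -/
theorem flow_nonneg_young_age_wide_pairs4
    (hmono : ∀ u v : ℕ → ℝ, SeqBox γ u → SeqBox γ v → (∀ j, u j ≤ v j) → B u ≤ B v)
    (hL : ∀ k, 0 ≤ L k) (hb : 0 < b) (hlo : ∀ u, SeqBox γ u → b ≤ B u) (hdom : ∀ u, SeqBox γ u → ∑ k ∈ range K, L k * u k ≤ B u)
    (hh : SeqBox γ h) (hf : MemFlow B gIR h) (hg : ∀ t, 0 < g t ∧ g t ≤ 1)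
    (hgF : ∀ t, 1 ≤ g t * (1 + ∑ k ∈ range K, L k * h (t + k) ^ 3 / 2))
    {a₀ : ℕ} (ha0 : 1 ≤ a₀) (ha0K : a₀ < K)
    {r : ℕ} {a p : ℕ → ℕ} (hr : 1 ≤ r) (hap : ∀ j, 1 ≤ j → j < r → a j ≤ p j ∧ p j ≤ 4 * a j) (hpK : ∀ j, 1 ≤ j → j < r → p j < K)
    (hsep0 : 1 < r → 72 * a₀ ≤ a 1) (hsep : ∀ j, 1 ≤ j → j + 1 < r → 72 * p j ≤ a (j + 1))
    (hLa : ∀ l, l < K → l ≠ a₀ → (∀ j, 1 ≤ j → j < r → l ≠ a j ∧ l ≠ p j) → L l = 0)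
    {N : ℕ} {KL : ℕ → ℕ → ℕ → ℝ}
    (hKL : ∀ k n l, KL k n l = if 0 < k ∧ k < K ∧ l < k then L k * h (n + k) ^ 3 / 2 * ∏ t ∈ Ico (n + 1 + l) (n + k + 1), g t else 0)
    {KA : ℕ → ℕ → ℕ → ℝ} {RA : ℕ → (ℕ → ℝ) → ℕ → ℝ}
    (hRA : ∀ i v m, RA i v m = ∑ l ∈ range K, KA i m l * v (m + 1 + l))
    (hKA : ∀ i m l, KA i m l = KL i m l + KA (i + 1) m l) (hKAtop : ∀ m l, KA K m l = 0)
    {e ε : ℕ → ℝ} (he0 : ∀ m, 0 ≤ e m) (hea : ∀ m, e (m + 1) ≤ e m)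
    (hεt : ∀ m, N < m → ε m = 0) (hεrec : ∀ m, ε m = e m - RA 1 ε m) : ∀ m, 0 ≤ ε m ∧ ε m ≤ e m := by
  refine flow_nonneg_wide_pair_levels_of_cap hmono hL hb hlo hdom hh hf hg hgF (by omega) (κ := 47 / 200) (s₀ := 7072 / 10000) (s := 129 / 200)
    (R₀ := 72) (F := 4) (by norm_num) (by norm_num) (by norm_num) (by norm_num) (by norm_num) (by norm_num)
    (fun lo hi q h1 h2 h3 h4 => wide_pair_load_le4 hmono hL hb hlo hdom hh hf h1 h2 h3 h4 q) (S₀ := {a₀}) (hi₀ := a₀)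
    (fun k hk => ?_) (fun k hk => ?_) (by omega) (fun q => ?_) hr hap hpK hsep0 hsep (fun l hl hl0 hno => ?_) hKL hRA hKA hKAtop he0 hea hεt hεrec
  · rw [mem_singleton] at hk; subst hk; exact ⟨ha0, ha0K⟩
  · rw [mem_singleton] at hk; omega
  · rw [sum_singleton]
    have ha0r : (1 : ℝ) ≤ a₀ := by exact_mod_cast ha0
    exact load_le_of_sq hmono hL hb hlo hdom hh hf ha0 ha0K (so := 7072 / 10000) (by norm_num) (by nlinarith) q
  · exact hLa l hl (fun h1 => hl0 (by rw [h1]; exact mem_singleton_self _)) hno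

/-- **THE CENSUS YOUNG PAIR `{1, k₂}`, `2 ≤ k₂ ≤ 29`, BELOW A ×95 CHAIN OF OLD PAIRS OF SPAN `≤ 8`, ANY NUMBER OF LEVELS.**  Profile carried by
`{1, k₂} ∪ ⋃_{1≤j<r} {a j, p j}` with `a j ≤ p j ≤ 8·a j`, `95k₂ ≤ a 1`, `95·p j ≤ a (j+1)`: `0 ≤ ε ≤ e` at every pin, every horizon, every damping of the
self-consistent class (`κ = 1∕5`, caps `0.8333` (E97c) and `17 / 25` (§1), `R₀ = 95`: `3.464 ≤ 3.496`). [folklore] -/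
theorem flow_nonneg_census_young_pair_wide_pairs8
    (hmono : ∀ u v : ℕ → ℝ, SeqBox γ u → SeqBox γ v → (∀ j, u j ≤ v j) → B u ≤ B v)
    (hL : ∀ k, 0 ≤ L k) (hb : 0 < b) (hlo : ∀ u, SeqBox γ u → b ≤ B u) (hdom : ∀ u, SeqBox γ u → ∑ k ∈ range K, L k * u k ≤ B u)
    (hh : SeqBox γ h) (hf : MemFlow B gIR h) (hg : ∀ t, 0 < g t ∧ g t ≤ 1)
    (hgF : ∀ t, 1 ≤ g t * (1 + ∑ k ∈ range K, L k * h (t + k) ^ 3 / 2))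
    {k₂ : ℕ} (hk2 : 2 ≤ k₂) (hk29 : k₂ ≤ 29) (hk2K : k₂ < K)
    {r : ℕ} {a p : ℕ → ℕ} (hr : 1 ≤ r) (hap : ∀ j, 1 ≤ j → j < r → a j ≤ p j ∧ p j ≤ 8 * a j) (hpK : ∀ j, 1 ≤ j → j < r → p j < K)
    (hsep0 : 1 < r → 95 * k₂ ≤ a 1) (hsep : ∀ j, 1 ≤ j → j + 1 < r → 95 * p j ≤ a (j + 1))
    (hLa : ∀ l, l < K → l ≠ 1 → l ≠ k₂ → (∀ j, 1 ≤ j → j < r → l ≠ a j ∧ l ≠ p j) → L l = 0)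
    {N : ℕ} {KL : ℕ → ℕ → ℕ → ℝ}
    (hKL : ∀ k n l, KL k n l = if 0 < k ∧ k < K ∧ l < k then L k * h (n + k) ^ 3 / 2 * ∏ t ∈ Ico (n + 1 + l) (n + k + 1), g t else 0)
    {KA : ℕ → ℕ → ℕ → ℝ} {RA : ℕ → (ℕ → ℝ) → ℕ → ℝ}
    (hRA : ∀ i v m, RA i v m = ∑ l ∈ range K, KA i m l * v (m + 1 + l))
    (hKA : ∀ i m l, KA i m l = KL i m l + KA (i + 1) m l) (hKAtop : ∀ m l, KA K m l = 0)
    {e ε : ℕ → ℝ} (he0 : ∀ m, 0 ≤ e m) (hea : ∀ m, e (m + 1) ≤ e m)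
    (hεt : ∀ m, N < m → ε m = 0) (hεrec : ∀ m, ε m = e m - RA 1 ε m) : ∀ m, 0 ≤ ε m ∧ ε m ≤ e m := by
  refine flow_nonneg_wide_pair_levels_of_cap hmono hL hb hlo hdom hh hf hg hgF (by omega) (κ := 1 / 5) (s₀ := 8333 / 10000) (s := 17 / 25)
    (R₀ := 95) (F := 8) (by norm_num) (by norm_num) (by norm_num) (by norm_num) (by norm_num) (by norm_num)
    (fun lo hi q h1 h2 h3 h4 => wide_pair_load_le8 hmono hL hb hlo hdom hh hf h1 h2 h3 h4 q) (S₀ := {1, k₂}) (hi₀ := k₂)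
    (fun k hk => ?_) (fun k hk => ?_) (by omega) (fun q => ?_) hr hap hpK hsep0 hsep (fun l hl hl0 hno => ?_) hKL hRA hKA hKAtop he0 hea hεt hεrec
  · simp only [mem_insert, mem_singleton] at hk; rcases hk with rfl | rfl <;> omega
  · simp only [mem_insert, mem_singleton] at hk; rcases hk with rfl | rfl <;> omega
  · rw [sum_pair (show (1 : ℕ) ≠ k₂ by omega), Nat.cast_one, one_mul]
    exact young_pair_load_le hmono hL hb hlo hdom hh hf hk2 hk29 hk2K q
  · refine hLa l hl (fun h1 => hl0 ?_) (fun h2 => hl0 ?_) hno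
    · rw [h1]; exact mem_insert_self _ _
    · rw [h2]; exact mem_insert_of_mem (mem_singleton_self _)

/-- **ANY YOUNG AGE BELOW A ×95 CHAIN OF OLD PAIRS OF SPAN `≤ 8`, ANY NUMBER OF LEVELS.**  Profile carried by `{a₀} ∪ ⋃_{1≤j<r} {a j, p j}` with
`a₀ ≥ 1` ARBITRARY, `a j ≤ p j ≤ 8·a j`, `95a₀ ≤ a 1`, `95·p j ≤ a (j+1)`: `0 ≤ ε ≤ e` at every pin (`κ = 1 / 5`, caps `0.7072` ((E94b) `load_le_of_sq`,
any age) and `17 / 25` (§1), `R₀ = 95`: `3.464 ≤ 3.496`). [folklore] -/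
theorem flow_nonneg_young_age_wide_pairs8
    (hmono : ∀ u v : ℕ → ℝ, SeqBox γ u → SeqBox γ v → (∀ j, u j ≤ v j) → B u ≤ B v)
    (hL : ∀ k, 0 ≤ L k) (hb : 0 < b) (hlo : ∀ u, SeqBox γ u → b ≤ B u) (hdom : ∀ u, SeqBox γ u → ∑ k ∈ range K, L k * u k ≤ B u)
    (hh : SeqBox γ h) (hf : MemFlow B gIR h) (hg : ∀ t, 0 < g t ∧ g t ≤ 1)
    (hgF : ∀ t, 1 ≤ g t * (1 + ∑ k ∈ range K, L k * h (t + k) ^ 3 / 2))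
    {a₀ : ℕ} (ha0 : 1 ≤ a₀) (ha0K : a₀ < K)
    {r : ℕ} {a p : ℕ → ℕ} (hr : 1 ≤ r) (hap : ∀ j, 1 ≤ j → j < r → a j ≤ p j ∧ p j ≤ 8 * a j) (hpK : ∀ j, 1 ≤ j → j < r → p j < K)
    (hsep0 : 1 < r → 95 * a₀ ≤ a 1) (hsep : ∀ j, 1 ≤ j → j + 1 < r → 95 * p j ≤ a (j + 1))
    (hLa : ∀ l, l < K → l ≠ a₀ → (∀ j, 1 ≤ j → j < r → l ≠ a j ∧ l ≠ p j) → L l = 0)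
    {N : ℕ} {KL : ℕ → ℕ → ℕ → ℝ}
    (hKL : ∀ k n l, KL k n l = if 0 < k ∧ k < K ∧ l < k then L k * h (n + k) ^ 3 / 2 * ∏ t ∈ Ico (n + 1 + l) (n + k + 1), g t else 0)
    {KA : ℕ → ℕ → ℕ → ℝ} {RA : ℕ → (ℕ → ℝ) → ℕ → ℝ}
    (hRA : ∀ i v m, RA i v m = ∑ l ∈ range K, KA i m l * v (m + 1 + l))
    (hKA : ∀ i m l, KA i m l = KL i m l + KA (i + 1) m l) (hKAtop : ∀ m l, KA K m l = 0)
    {e ε : ℕ → ℝ} (he0 : ∀ m, 0 ≤ e m) (hea : ∀ m, e (m + 1) ≤ e m)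
    (hεt : ∀ m, N < m → ε m = 0) (hεrec : ∀ m, ε m = e m - RA 1 ε m) : ∀ m, 0 ≤ ε m ∧ ε m ≤ e m := by
  refine flow_nonneg_wide_pair_levels_of_cap hmono hL hb hlo hdom hh hf hg hgF (by omega) (κ := 1 / 5) (s₀ := 7072 / 10000) (s := 17 / 25)
    (R₀ := 95) (F := 8) (by norm_num) (by norm_num) (by norm_num) (by norm_num) (by norm_num) (by norm_num)
    (fun lo hi q h1 h2 h3 h4 => wide_pair_load_le8 hmono hL hb hlo hdom hh hf h1 h2 h3 h4 q) (S₀ := {a₀}) (hi₀ := a₀)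
    (fun k hk => ?_) (fun k hk => ?_) (by omega) (fun q => ?_) hr hap hpK hsep0 hsep (fun l hl hl0 hno => ?_) hKL hRA hKA hKAtop he0 hea hεt hεrec
  · rw [mem_singleton] at hk; subst hk; exact ⟨ha0, ha0K⟩
  · rw [mem_singleton] at hk; omega
  · rw [sum_singleton]
    have ha0r : (1 : ℝ) ≤ a₀ := by exact_mod_cast ha0
    exact load_le_of_sq hmono hL hb hlo hdom hh hf ha0 ha0K (so := 7072 / 10000) (by norm_num) (by nlinarith) q
  · exact hLa l hl (fun h1 => hl0 (by rw [h1]; exact mem_singleton_self _)) hno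

/-- **THE CENSUS YOUNG PAIR `{1, k₂}`, `2 ≤ k₂ ≤ 29`, BELOW A ×128 CHAIN OF OLD PAIRS OF SPAN `≤ 16`, ANY NUMBER OF LEVELS.**  Profile carried by
`{1, k₂} ∪ ⋃_{1≤j<r} {a j, p j}` with `a j ≤ p j ≤ 16·a j`, `128k₂ ≤ a 1`, `128·p j ≤ a (j+1)`: `0 ≤ ε ≤ e` at every pin, every horizon, every damping of the
self-consistent class (`κ = 1∕5`, caps `0.8333` (E97c) and `143 / 200` (§1), `R₀ = 128`: `3.632 ≤ 3.6352`). [folklore] -/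
theorem flow_nonneg_census_young_pair_wide_pairs16
    (hmono : ∀ u v : ℕ → ℝ, SeqBox γ u → SeqBox γ v → (∀ j, u j ≤ v j) → B u ≤ B v)
    (hL : ∀ k, 0 ≤ L k) (hb : 0 < b) (hlo : ∀ u, SeqBox γ u → b ≤ B u) (hdom : ∀ u, SeqBox γ u → ∑ k ∈ range K, L k * u k ≤ B u)
    (hh : SeqBox γ h) (hf : MemFlow B gIR h) (hg : ∀ t, 0 < g t ∧ g t ≤ 1)
    (hgF : ∀ t, 1 ≤ g t * (1 + ∑ k ∈ range K, L k * h (t + k) ^ 3 / 2))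
    {k₂ : ℕ} (hk2 : 2 ≤ k₂) (hk29 : k₂ ≤ 29) (hk2K : k₂ < K)
    {r : ℕ} {a p : ℕ → ℕ} (hr : 1 ≤ r) (hap : ∀ j, 1 ≤ j → j < r → a j ≤ p j ∧ p j ≤ 16 * a j) (hpK : ∀ j, 1 ≤ j → j < r → p j < K)
    (hsep0 : 1 < r → 128 * k₂ ≤ a 1) (hsep : ∀ j, 1 ≤ j → j + 1 < r → 128 * p j ≤ a (j + 1))
    (hLa : ∀ l, l < K → l ≠ 1 → l ≠ k₂ → (∀ j, 1 ≤ j → j < r → l ≠ a j ∧ l ≠ p j) → L l = 0)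
    {N : ℕ} {KL : ℕ → ℕ → ℕ → ℝ}
    (hKL : ∀ k n l, KL k n l = if 0 < k ∧ k < K ∧ l < k then L k * h (n + k) ^ 3 / 2 * ∏ t ∈ Ico (n + 1 + l) (n + k + 1), g t else 0)
    {KA : ℕ → ℕ → ℕ → ℝ} {RA : ℕ → (ℕ → ℝ) → ℕ → ℝ}
    (hRA : ∀ i v m, RA i v m = ∑ l ∈ range K, KA i m l * v (m + 1 + l))
    (hKA : ∀ i m l, KA i m l = KL i m l + KA (i + 1) m l) (hKAtop : ∀ m l, KA K m l = 0)
    {e ε : ℕ → ℝ} (he0 : ∀ m, 0 ≤ e m) (hea : ∀ m, e (m + 1) ≤ e m)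
    (hεt : ∀ m, N < m → ε m = 0) (hεrec : ∀ m, ε m = e m - RA 1 ε m) : ∀ m, 0 ≤ ε m ∧ ε m ≤ e m := by
  refine flow_nonneg_wide_pair_levels_of_cap hmono hL hb hlo hdom hh hf hg hgF (by omega) (κ := 1 / 5) (s₀ := 8333 / 10000) (s := 143 / 200)
    (R₀ := 128) (F := 16) (by norm_num) (by norm_num) (by norm_num) (by norm_num) (by norm_num) (by norm_num)
    (fun lo hi q h1 h2 h3 h4 => wide_pair_load_le16 hmono hL hb hlo hdom hh hf h1 h2 h3 h4 q) (S₀ := {1, k₂}) (hi₀ := k₂)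
    (fun k hk => ?_) (fun k hk => ?_) (by omega) (fun q => ?_) hr hap hpK hsep0 hsep (fun l hl hl0 hno => ?_) hKL hRA hKA hKAtop he0 hea hεt hεrec
  · simp only [mem_insert, mem_singleton] at hk; rcases hk with rfl | rfl <;> omega
  · simp only [mem_insert, mem_singleton] at hk; rcases hk with rfl | rfl <;> omega
  · rw [sum_pair (show (1 : ℕ) ≠ k₂ by omega), Nat.cast_one, one_mul]
    exact young_pair_load_le hmono hL hb hlo hdom hh hf hk2 hk29 hk2K q
  · refine hLa l hl (fun h1 => hl0 ?_) (fun h2 => hl0 ?_) hno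
    · rw [h1]; exact mem_insert_self _ _
    · rw [h2]; exact mem_insert_of_mem (mem_singleton_self _)

end Summit.QuantumFields.BalabanUV.Beta.EriceRemainderEnclosureHistoryAutonomyComparisonAgeCompositionWideOldPairSeparatedAges
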